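import Literature.Topology.Immersions.WrinkledEmbeddingsRoundCollar
import Literature.Topology.FourManifolds.DehnSurgeryTubularNbhdProofs
import Mathlib.Geometry.Euclidean.Inversion.Calculus
import Mathlib.Analysis.Calculus.BumpFunction.InnerProduct
import Mathlib.Analysis.Calculus.LocalExtr.Basic
import HarnessLib

/-!
# Round lower part of an embedded closed hypersurface of `ℝ⁵` (discharge of
# `exists_isSmoothEmbedding_roundPart`)

Topic `Literature/Topology/Immersions`; companion of `WrinkledEmbeddingsRoundCollar.lean`.  This
file PROVES the named fact `Literature.Topology.Immersions.exists_isSmoothEmbedding_roundPart`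
(Kosinski, *Differential Manifolds* (1993), Ch. VI: the tube of Prop. 1.3 and `M # Sᵐ = M`,
Thm. 2.2 (c), in embedded form): a closed nonempty smooth `4`-manifold `M` that embeds smoothly
in `ℝ⁵` admits, for every `0 < δ₁ < 1`, a smooth embedding `ι₁ : M ↪ ℝ⁵` with ROUND LOWER PART,
`range ι₁ ∩ {h ≤ 1 - δ₁} = S⁴ ∩ {h ≤ 1 - δ₁}` (`h = p₄`):
`Literature.Topology.Immersions.exists_isSmoothEmbedding_roundPart_holds`.

## The proof formalised here

The printed construction (module docstring of the statement file, after Kosinski VI (1.3)) hangs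
the unit sphere by a thin vertical tube from a lowest point of `ι₀(M)`.  We realise the same
embedded connected sum `M # S⁴ = M` by a shorter road in Mathlib, replacing the tube (a
hypersurface of revolution, whose smoothness and embeddedness would have to be checked by hand)
by two global diffeomorphisms of (open subsets of) the ambient `ℝ⁵`, under which smooth
embeddings are transported by the chain rule:

1. **Lowest point and local graph** (Kosinski's first step, verbatim).  At a minimum `m₀` of the
   height `h ∘ ι₀` (compactness) the differential of `h ∘ ι₀` vanishes, so in the chart `φ` at `m₀`
   the horizontal part `shadowProj ∘ ι₀ ∘ φ⁻¹` of the chart representative has injective, hence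
   invertible, derivative; by the inverse function theorem on manifolds (the tree's
   `Literature.Topology.FourManifolds.isLocalDiffeomorphAt_of_mfderiv`) it has a smooth local
   inverse `ψ`, and `ι₀(M)` is, near `ι₀ m₀`, the graph `h = g(a)` of the smooth function
   `g = h ∘ ι₀ ∘ φ⁻¹ ∘ ψ` of the shadow `a`.
2. **Flattening by a vertical shear.**  With a bump `χ` centred at the shadow `a₀` of `ι₀ m₀`
   (`= 1` on `B(a₀, r₁/2)`, supported in `B(a₀, r₁)`, where `g` is defined), the shear
   `Θ(p) = p - χ(a)(g(a) - h(ι₀ m₀)) e₄`, `a = shadowProj p`, is a diffeomorphism of `ℝ⁵`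
   (`RoundPart.vShear`; it preserves vertical lines and has the explicit inverse with `+`), so
   `ι' = Θ ∘ ι₀ - ι₀ m₀` is again an injective immersion; its image contains the flat horizontal
   disc of radius `r₁/2` about the origin and, near the origin, nothing else
   (`RoundPart.exists_flat_reembedding`: by compactness the part of `M` outside the graphical
   neighbourhood of `m₀` is mapped outside a ball `B(0, ρ)`).
3. **Rounding by an inversion.**  The inversion of `ℝ⁵` in the sphere of radius `2t` about
   `c = 2t² e₄`, followed by the translation by `(1 - 2t²) e₄` (`RoundPart.roundingMap`), is a
   conformal diffeomorphism of `ℝ⁵ ∖ {c}` mapping the horizontal hyperplane `{h = 0}` onto the unit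
   sphere minus the north pole `e₄` (`0 ↦ -e₄`; `RoundPart.norm_roundingMap_of_apply_four_eq_zero`,
   `RoundPart.roundingMap_inversion`) and the exterior of `B(0, ρ)` into the ball of radius `8t²/ρ`
   about `e₄`.  For `t` small against `r₁`, `ρ`, `δ₁`, the flat disc covers the cap
   `S⁴ ∩ {h ≤ 1 - δ₁}` and the rest of `M` lands in `{h > 1 - δ₁}`
   (`RoundPart.exists_roundingMap_range`), which is the asserted round lower part; `ι₁` is a
   smooth embedding by the injective-immersion criterion on a compact manifold
   (`Literature.Topology.FourManifolds.isSmoothEmbedding_of_injective_of_injective_mfderiv`).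

Steps 2–3 replace Kosinski's tube `Sᵐ⁻¹ × I` joining the flattened disc to a sphere hung below
(VI 1.3) — the resulting embedded manifold is the same `M # S⁴ ≅ M` (VI 2.2 (c)) and the
statement proved is exactly the vendored one; only the shape of the neck differs (here the neck
is the conformal image of the complement of the flat disc, squeezed into a small polar cap).

## References

* A. A. Kosinski, *Differential Manifolds*, Pure and Applied Mathematics 138, Academic Press
  (1993), Ch. VI §1 (Prop. 1.3: connected sum along a tube) and §2 (Thm. 2.2 (c): `M # Sᵐ = M`).
  [Kosinski1993]
* J. M. Lee, *Introduction to Smooth Manifolds*, 2nd ed. (2013), Thm. 4.5 (inverse function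
  theorem for manifolds), Prop. 4.1, Thm. 4.25 / Prop. 5.22 (injective immersions of compact
  manifolds are embeddings) — the Mathlib-level tools, via the tree files
  `Literature/Topology/FourManifolds/{InverseFunctionTheorem, ImmersionCriterion,
  DehnSurgeryTubularNbhdProofs}.lean`.
-/

open scoped Manifold ContDiff Topology InnerProductSpace
open Set Function Metric

noncomputable section

namespace Literature.Topology.Immersions

/-- Local notation: `𝔼 n` is the model Euclidean space `EuclideanSpace ℝ (Fin n)`. -/
local notation "𝔼 " n:arg => EuclideanSpace ℝ (Fin n)

/-- Local notation: the round unit `4`-sphere of `ℝ⁵` with Mathlib's manifold structure. -/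
local notation "𝕊⁴" => (Metric.sphere (0 : EuclideanSpace ℝ (Fin 5)) 1)

namespace RoundPart

/-! ### §0 Coordinates: the north pole `e₄`, the shadow, heights -/

/-- The north pole `e₄ = (0, 0, 0, 0, 1)` of the unit sphere of `ℝ⁵` (the unit vertical vector).
[folklore] -/
def e4 : 𝔼 5 := EuclideanSpace.single 4 1

/-- `e₄` has height `1`. [folklore] -/
@[simp] theorem e4_apply_four : e4 4 = 1 := by simp [e4]

/-- `‖e₄‖ = 1`. [folklore] -/
@[simp] theorem norm_e4 : ‖e4‖ = 1 := by simp [e4]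

/-- `⟪v, e₄⟫ = v₄`. [folklore] -/
theorem inner_e4_right (v : 𝔼 5) : ⟪v, e4⟫_ℝ = v 4 := by
  simp [e4, EuclideanSpace.inner_single_right]

/-- `|v₄| ≤ ‖v‖`. [folklore] -/
theorem abs_apply_four_le_norm (v : 𝔼 5) : |v 4| ≤ ‖v‖ := by
  have h := abs_real_inner_le_norm v e4
  rwa [inner_e4_right, norm_e4, mul_one] at h

/-- The shadow of the vertical vector vanishes. [folklore] -/
theorem shadowProj_e4 : shadowProj e4 = 0 := by
  ext i
  fin_cases i <;> simp [shadowProj, e4]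

/-- `⇑shadowProjL = shadowProj` (definitional). [folklore] -/
theorem coe_shadowProjL : ⇑shadowProjL = shadowProj := rfl

/-- Coordinates of the shadow. [folklore] -/
theorem shadowProj_apply (p : 𝔼 5) (i : Fin 4) : shadowProj p i = p (Fin.castSucc i) := by
  fin_cases i <;> simp [shadowProj]

/-- The shadow does not increase the norm. [folklore] -/
theorem norm_shadowProj_le (p : 𝔼 5) : ‖shadowProj p‖ ≤ ‖p‖ := by
  rw [EuclideanSpace.norm_eq, EuclideanSpace.norm_eq]
  apply Real.sqrt_le_sqrt
  simp only [Fin.sum_univ_four, Fin.sum_univ_five, shadowProj_apply]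
  simp only [Fin.castSucc_zero, Fin.castSucc_one]
  have h2 : (Fin.castSucc (2 : Fin 4) : Fin 5) = 2 := rfl
  have h3 : (Fin.castSucc (3 : Fin 4) : Fin 5) = 3 := rfl
  rw [h2, h3]
  nlinarith [sq_nonneg (p 4)]

/-- A point of `ℝ⁵` is determined by its shadow and its height. [folklore] -/
theorem ext_of_shadowProj_eq {p q : 𝔼 5} (hs : shadowProj p = shadowProj q) (h4 : p 4 = q 4) :
    p = q := by
  have h := fun j : Fin 4 => congrArg (fun v : 𝔼 4 => v j) hs
  ext i
  fin_cases i
  · simpa [shadowProj] using h 0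
  · simpa [shadowProj] using h 1
  · simpa [shadowProj] using h 2
  · simpa [shadowProj] using h 3
  · simpa using h4

/-! ### §1 Transport of injective immersions `M⁴ → ℝ⁵` along maps of `ℝ⁵` -/

section Comp

variable {M : Type*} [TopologicalSpace M] [ChartedSpace (𝔼 4) M]

/-- Post-composition with a map of `ℝ⁵` that is `C^∞` along the range keeps `C^∞`. [folklore] -/
theorem contMDiff_comp_of_contDiffAt {ι : M → 𝔼 5} (hι : ContMDiff (𝓡 4) (𝓡 5) ∞ ι)
    {Ψ : 𝔼 5 → 𝔼 5} (hΨ : ∀ m, ContDiffAt ℝ ∞ Ψ (ι m)) :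
    ContMDiff (𝓡 4) (𝓡 5) ∞ (Ψ ∘ ι) := fun m =>
  (hΨ m).contMDiffAt.comp m (hι m)

/-- Chain rule for the post-composition with a map of `ℝ⁵`. [folklore] -/
theorem mfderiv_comp_of_contDiffAt {ι : M → 𝔼 5} (hι : ContMDiff (𝓡 4) (𝓡 5) ∞ ι)
    {Ψ : 𝔼 5 → 𝔼 5} {m : M} (hΨ : ContDiffAt ℝ ∞ Ψ (ι m)) :
    mfderiv (𝓡 4) (𝓡 5) (Ψ ∘ ι) m = (fderiv ℝ Ψ (ι m)).comp (mfderiv (𝓡 4) (𝓡 5) ι m) := by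
  have h1 : HasMFDerivAt (𝓡 4) (𝓡 5) ι m (mfderiv (𝓡 4) (𝓡 5) ι m) :=
    ((hι m).mdifferentiableAt (by simp)).hasMFDerivAt
  have h2 : HasMFDerivAt (𝓡 5) (𝓡 5) Ψ (ι m) (fderiv ℝ Ψ (ι m)) :=
    ((hΨ.differentiableAt (by simp)).hasFDerivAt).hasMFDerivAt
  exact (h2.comp m h1).mfderiv

/-- Post-composition with a map of `ℝ⁵` immersive along the range keeps the differential
injective. [folklore] -/
theorem injective_mfderiv_comp_of_contDiffAt {ι : M → 𝔼 5} (hι : ContMDiff (𝓡 4) (𝓡 5) ∞ ι)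
    {Ψ : 𝔼 5 → 𝔼 5} {m : M} (hΨ : ContDiffAt ℝ ∞ Ψ (ι m))
    (hd : Injective (mfderiv (𝓡 4) (𝓡 5) ι m)) (hΨd : Injective (fderiv ℝ Ψ (ι m))) :
    Injective (mfderiv (𝓡 4) (𝓡 5) (Ψ ∘ ι) m) := by
  rw [mfderiv_comp_of_contDiffAt hι hΨ]
  exact hΨd.comp hd

/-- A smooth embedding `M⁴ ↪ ℝ⁵` has injective differential (Lee (2013), Prop. 4.1, through the
tree's `Literature.Topology.FourManifolds.mfderiv_injective_of_isImmersion`). [folklore] -/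
theorem injective_mfderiv_of_isSmoothEmbedding {ι : M → 𝔼 5}
    (hι : Manifold.IsSmoothEmbedding (𝓡 4) (𝓡 5) ∞ ι) (m : M) :
    Injective (mfderiv (𝓡 4) (𝓡 5) ι m) :=
  Literature.Topology.FourManifolds.mfderiv_injective_of_isImmersion hι.isImmersion (by simp) m

end Comp

/-! ### §2 The vertical shear (flattening a graph) -/

section Shear

variable (β : 𝔼 4 → ℝ)

/-- The VERTICAL SHEAR of `ℝ⁵` by `β ∘ shadow`: `p ↦ p - β(shadowProj p) e₄`; it preserves every
vertical line, and has the inverse `p ↦ p + β(shadowProj p) e₄`.  For `β = χ · (g - y₀)` it maps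
the graph `{h = g(a)}` over `{χ = 1}` onto the flat piece `{h = y₀}`. [folklore] -/
def vShear (p : 𝔼 5) : 𝔼 5 := p - β (shadowProj p) • e4

/-- The shear preserves shadows. [folklore] -/
theorem shadowProj_vShear (p : 𝔼 5) : shadowProj (vShear β p) = shadowProj p := by
  change shadowProjL (p - β (shadowProj p) • e4) = shadowProj p
  rw [map_sub, map_smul, coe_shadowProjL, shadowProj_e4, smul_zero, sub_zero]

/-- The height after the shear. [folklore] -/
theorem vShear_apply_four (p : 𝔼 5) : vShear β p 4 = p 4 - β (shadowProj p) := by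
  simp [vShear]

/-- The shear is injective. [folklore] -/
theorem vShear_injective : Injective (vShear β) := by
  intro p q h
  have hs : shadowProj p = shadowProj q := by
    rw [← shadowProj_vShear β p, h, shadowProj_vShear]
  have h' : vShear β p + β (shadowProj p) • e4 = vShear β q + β (shadowProj q) • e4 := by
    rw [h, hs]
  simpa [vShear] using h'

/-- The shear is `C^∞` when `β` is. [folklore] -/
theorem contDiff_vShear (hβ : ContDiff ℝ ∞ β) : ContDiff ℝ ∞ (vShear β) := by
  have h1 : ContDiff ℝ ∞ (fun q : 𝔼 5 => β (shadowProj q)) := by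
    rw [← coe_shadowProjL]; exact hβ.comp shadowProjL.contDiff
  exact contDiff_id.sub (h1.smul contDiff_const)

/-- The differential of the shear: `v ↦ v - (dβ(shadow p) (shadow v)) e₄`. [folklore] -/
theorem hasFDerivAt_vShear (hβ : ContDiff ℝ ∞ β) (p : 𝔼 5) :
    HasFDerivAt (vShear β) (ContinuousLinearMap.id ℝ (𝔼 5) -
      ((fderiv ℝ β (shadowProj p)).comp shadowProjL).smulRight e4) p := by
  have hb : HasFDerivAt β (fderiv ℝ β (shadowProj p)) (shadowProjL p) :=
    (hβ.differentiable (by simp) _).hasFDerivAt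
  have h1 : HasFDerivAt (fun q : 𝔼 5 => β (shadowProj q))
      ((fderiv ℝ β (shadowProj p)).comp shadowProjL) p := hb.comp p shadowProjL.hasFDerivAt
  exact (hasFDerivAt_id p).sub (h1.smul_const e4)

/-- The shear is an immersion (indeed a diffeomorphism). [folklore] -/
theorem injective_fderiv_vShear (hβ : ContDiff ℝ ∞ β) (p : 𝔼 5) :
    Injective (fderiv ℝ (vShear β) p) := by
  rw [(hasFDerivAt_vShear β hβ p).fderiv]
  intro v w hvw
  simp only [sub_apply, ContinuousLinearMap.id_apply,
    ContinuousLinearMap.smulRight_apply, ContinuousLinearMap.comp_apply] at hvw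
  have hs : shadowProjL v = shadowProjL w := by
    have h := congrArg shadowProjL hvw
    rwa [map_sub, map_sub, map_smul, map_smul, coe_shadowProjL, shadowProj_e4, smul_zero,
      smul_zero, sub_zero, sub_zero] at h
  rw [hs] at hvw
  exact sub_left_injective hvw

end Shear

/-! ### §3 The rounding map (an inversion of `ℝ⁵`) -/

section RoundingMap

variable (t : ℝ)

/-- Centre `c = 2t² e₄` of the inversion. [folklore] -/
def invCenter : 𝔼 5 := (2 * t ^ 2) • e4

/-- Height of the centre. [folklore] -/
@[simp] theorem invCenter_apply_four : invCenter t 4 = 2 * t ^ 2 := by simp [invCenter]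

/-- Norm of the centre. [folklore] -/
theorem norm_invCenter : ‖invCenter t‖ = 2 * t ^ 2 := by
  rw [invCenter, norm_smul, norm_e4, mul_one, Real.norm_of_nonneg (by positivity)]

/-- The ROUNDING MAP: the inversion of `ℝ⁵` in the sphere of radius `2t` about `c = 2t² e₄`
followed by the translation by `(1 - 2t²) e₄`, i.e. `p ↦ e₄ + (2t)² (p - c)/‖p - c‖²`.  It maps
the horizontal hyperplane `{h = 0}` onto the unit sphere minus the north pole (`0 ↦ -e₄`, the
point at horizontal distance `d` to height `(d² - 4t⁴)/(d² + 4t⁴)`), and the complement of the ball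
`B(0, ρ)`, `ρ ≥ 4t²`, into the ball of radius `8t²/ρ` about `e₄`. [folklore] -/
def roundingMap (p : 𝔼 5) : 𝔼 5 :=
  EuclideanGeometry.inversion (invCenter t) (2 * t) p + (1 - 2 * t ^ 2) • e4

/-- `Φ p - e₄ = (2t/‖p - c‖)² (p - c)`. [folklore] -/
theorem roundingMap_sub_e4 (p : 𝔼 5) :
    roundingMap t p - e4 = (2 * t / ‖p - invCenter t‖) ^ 2 • (p - invCenter t) := by
  simp only [roundingMap, EuclideanGeometry.inversion, dist_eq_norm, vsub_eq_sub, vadd_eq_add]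
  rw [show (invCenter t : 𝔼 5) = (2 * t ^ 2) • e4 from rfl]
  module

/-- `Φ p = (2t/‖p - c‖)² (p - c) + e₄`. [folklore] -/
theorem roundingMap_eq (p : 𝔼 5) :
    roundingMap t p = (2 * t / ‖p - invCenter t‖) ^ 2 • (p - invCenter t) + e4 := by
  rw [← roundingMap_sub_e4, sub_add_cancel]

/-- `‖Φ p - e₄‖ = (2t)²/‖p - c‖` off the centre. [folklore] -/
theorem norm_roundingMap_sub_e4 {p : 𝔼 5} (hp : p ≠ invCenter t) :
    ‖roundingMap t p - e4‖ = (2 * t) ^ 2 / ‖p - invCenter t‖ := by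
  have hd : ‖p - invCenter t‖ ≠ 0 := norm_ne_zero_iff.mpr (sub_ne_zero.mpr hp)
  rw [roundingMap_sub_e4, norm_smul, Real.norm_of_nonneg (by positivity)]
  field_simp

/-- Height bound: `Φ p` is within `(2t)²/‖p - c‖` of the north pole, in particular its height is at
least `1 - (2t)²/‖p - c‖`. [folklore] -/
theorem one_sub_le_roundingMap_apply_four {p : 𝔼 5} (hp : p ≠ invCenter t) :
    1 - (2 * t) ^ 2 / ‖p - invCenter t‖ ≤ roundingMap t p 4 := by
  have h1 : roundingMap t p 4 = 1 + (roundingMap t p - e4) 4 := by simp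
  have h2 := abs_apply_four_le_norm (roundingMap t p - e4)
  rw [norm_roundingMap_sub_e4 t hp] at h2
  rw [h1]
  linarith [neg_abs_le ((roundingMap t p - e4) 4)]

/-- **The rounding map sends the horizontal hyperplane into the unit sphere** (the image of a
hyperplane at distance `s` from the centre of an inversion of radius `R` is a sphere of diameter
`R²/s` through the centre; here `R² = 4t² = 2s`). [folklore] -/
theorem norm_roundingMap_of_apply_four_eq_zero (ht : t ≠ 0) {p : 𝔼 5} (hp : p 4 = 0) :
    ‖roundingMap t p‖ = 1 := by
  have hpc : p - invCenter t ≠ 0 := by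
    intro h
    have h' := congrArg (fun v : 𝔼 5 => v 4) h
    simp only [PiLp.sub_apply, hp, invCenter_apply_four, PiLp.zero_apply] at h'
    exact ht (by nlinarith [sq_nonneg t])
  have hd : ‖p - invCenter t‖ ≠ 0 := norm_ne_zero_iff.mpr hpc
  rw [roundingMap_eq]
  set d := ‖p - invCenter t‖ with hd_def
  have hsq : ‖(2 * t / d) ^ 2 • (p - invCenter t) + e4‖ ^ 2 = 1 := by
    rw [norm_add_sq_real, norm_smul, real_inner_smul_left, inner_e4_right, norm_e4,
      Real.norm_of_nonneg (by positivity), PiLp.sub_apply, hp, invCenter_apply_four, ← hd_def]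
    field_simp
    ring
  exact (pow_eq_one_iff_of_nonneg (norm_nonneg _) two_ne_zero).mp hsq

/-- **Explicit preimages**: `Φ (inversion c (2t) (q - (1 - 2t²) e₄)) = q` (an inversion is an
involution). [folklore] -/
theorem roundingMap_inversion (ht : t ≠ 0) (q : 𝔼 5) :
    roundingMap t (EuclideanGeometry.inversion (invCenter t) (2 * t)
      (q - (1 - 2 * t ^ 2) • e4)) = q := by
  rw [roundingMap, EuclideanGeometry.inversion_inversion _ (by positivity), sub_add_cancel]

/-- The preimage of a point of the unit sphere other than the north pole is horizontal.
[folklore] -/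
theorem inversion_pre_apply_four {q : 𝔼 5} (hq : ‖q‖ = 1) (hq4 : q 4 < 1) :
    EuclideanGeometry.inversion (invCenter t) (2 * t) (q - (1 - 2 * t ^ 2) • e4) 4 = 0 := by
  have hy : q - (1 - 2 * t ^ 2) • e4 - invCenter t = q - e4 := by
    rw [show (invCenter t : 𝔼 5) = (2 * t ^ 2) • e4 from rfl]; module
  have hd2 : ‖q - e4‖ ^ 2 = 2 * (1 - q 4) := by
    rw [norm_sub_sq_real, hq, inner_e4_right, norm_e4]; ring
  have h1q : 1 - q 4 ≠ 0 := (sub_pos.mpr hq4).ne'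
  have hd : ‖q - e4‖ ≠ 0 := by
    intro h; rw [h] at hd2; nlinarith
  simp only [EuclideanGeometry.inversion, dist_eq_norm, vsub_eq_sub, vadd_eq_add, hy,
    PiLp.add_apply, PiLp.smul_apply, PiLp.sub_apply, e4_apply_four, invCenter_apply_four,
    smul_eq_mul]
  rw [div_pow, hd2]
  field_simp
  ring

/-- The preimage of a point of the unit sphere of height `< 1` has norm at most
`2t² + (2t)²/(1 - q₄)`. [folklore] -/
theorem norm_inversion_pre_le {q : 𝔼 5} (hq4 : q 4 < 1) :
    ‖EuclideanGeometry.inversion (invCenter t) (2 * t) (q - (1 - 2 * t ^ 2) • e4)‖ ≤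
      2 * t ^ 2 + (2 * t) ^ 2 / (1 - q 4) := by
  have hy : q - (1 - 2 * t ^ 2) • e4 - invCenter t = q - e4 := by
    rw [show (invCenter t : 𝔼 5) = (2 * t ^ 2) • e4 from rfl]; module
  have hd : 1 - q 4 ≤ ‖q - e4‖ := by
    have := abs_apply_four_le_norm (q - e4)
    simp only [PiLp.sub_apply, e4_apply_four] at this
    rw [abs_sub_comm] at this
    linarith [le_abs_self (1 - q 4)]
  have hd0 : 0 < ‖q - e4‖ := by linarith
  simp only [EuclideanGeometry.inversion, dist_eq_norm, vsub_eq_sub, vadd_eq_add, hy]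
  calc ‖(2 * t / ‖q - e4‖) ^ 2 • (q - e4) + invCenter t‖
      ≤ ‖(2 * t / ‖q - e4‖) ^ 2 • (q - e4)‖ + ‖invCenter t‖ := norm_add_le _ _
    _ = (2 * t) ^ 2 / ‖q - e4‖ + 2 * t ^ 2 := by
        rw [norm_smul, Real.norm_of_nonneg (by positivity), norm_invCenter]
        field_simp
    _ ≤ (2 * t) ^ 2 / (1 - q 4) + 2 * t ^ 2 := by
        gcongr
    _ = 2 * t ^ 2 + (2 * t) ^ 2 / (1 - q 4) := by ring

/-- The rounding map is `C^∞` off the centre. [folklore] -/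
theorem contDiffAt_roundingMap {p : 𝔼 5} (hp : p ≠ invCenter t) :
    ContDiffAt ℝ ∞ (roundingMap t) p :=
  (contDiffAt_const.inversion contDiffAt_const contDiffAt_id hp).add contDiffAt_const

/-- The rounding map is injective (`t ≠ 0`). [folklore] -/
theorem roundingMap_injective (ht : t ≠ 0) {p q : 𝔼 5}
    (h : roundingMap t p = roundingMap t q) : p = q :=
  EuclideanGeometry.inversion_injective (invCenter t) (R := 2 * t) (by positivity)
    (add_right_cancel h)

/-- The rounding map is an immersion off the centre (its differential is a nonzero multiple of a
reflection). [folklore] -/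
theorem injective_fderiv_roundingMap (ht : t ≠ 0) {p : 𝔼 5} (hp : p ≠ invCenter t) :
    Injective (fderiv ℝ (roundingMap t) p) := by
  have hD := ((EuclideanGeometry.hasFDerivAt_inversion (c := invCenter t) (R := 2 * t) hp).add_const
    ((1 - 2 * t ^ 2) • e4)).fderiv
  rw [show (fun x => EuclideanGeometry.inversion (invCenter t) (2 * t) x + (1 - 2 * t ^ 2) • e4) =
    roundingMap t from rfl] at hD
  rw [hD]
  intro v w hvw
  have hk : (2 * t / dist p (invCenter t)) ^ 2 ≠ 0 := by
    have : dist p (invCenter t) ≠ 0 := dist_ne_zero.mpr hp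
    positivity
  have := smul_right_injective _ hk hvw
  exact (Submodule.reflection _).injective this

/-- **The rounding step.**  If the image of `ι : M → ℝ⁵` contains the flat horizontal disc of
radius `r` about the origin and is flat (height `0`) inside the ball `B(0, ρ)`, then for a
suitable `t > 0` the image avoids the centre of the rounding map and
`range (Φₜ ∘ ι) ∩ {h ≤ 1 - δ₁} = S⁴ ∩ {h ≤ 1 - δ₁}`. [folklore] -/
theorem exists_roundingMap_range {M : Type*} {ι : M → 𝔼 5} {r ρ δ₁ : ℝ} (hr : 0 < r)
    (hρ : 0 < ρ) (hδ₁ : 0 < δ₁) (hδ₁1 : δ₁ < 1)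
    (hA : ∀ p : 𝔼 5, p 4 = 0 → ‖p‖ < r → p ∈ range ι)
    (hB : ∀ m, ‖ι m‖ < ρ → ι m 4 = 0) :
    ∃ t : ℝ, 0 < t ∧ (∀ m, ι m ≠ invCenter t) ∧
      range (roundingMap t ∘ ι) ∩ {p : 𝔼 5 | p 4 ≤ 1 - δ₁} =
        (𝕊⁴ : Set (𝔼 5)) ∩ {p : 𝔼 5 | p 4 ≤ 1 - δ₁} := by
  -- the choice of `t`
  obtain ⟨t, ht0, ht1, htρ, htδρ, htδr⟩ : ∃ t : ℝ, 0 < t ∧ t ≤ 1 ∧ t ≤ ρ / 8 ∧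
      t ≤ δ₁ * ρ / 16 ∧ t ≤ δ₁ * r / 12 := by
    refine ⟨min 1 (min (ρ / 8) (min (δ₁ * ρ / 16) (δ₁ * r / 12))), ?_, min_le_left _ _,
      (min_le_right _ _).trans (min_le_left _ _),
      (min_le_right _ _).trans ((min_le_right _ _).trans (min_le_left _ _)),
      (min_le_right _ _).trans ((min_le_right _ _).trans (min_le_right _ _))⟩
    positivity
  have ht2 : t ^ 2 ≤ t := by nlinarith
  have hs : 2 * t ^ 2 ≤ ρ / 4 := by nlinarith
  have hcap : (2 * t) ^ 2 / (ρ / 2) < δ₁ := by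
    rw [div_lt_iff₀ (by positivity)]; nlinarith
  have hdisc : 2 * t ^ 2 + (2 * t) ^ 2 / δ₁ < r := by
    have h3 : (2 * t) ^ 2 / δ₁ ≤ 4 * t / δ₁ := by
      gcongr; nlinarith
    have h4 : 4 * t / δ₁ ≤ r / 3 := by
      rw [div_le_iff₀ hδ₁]; nlinarith
    nlinarith
  refine ⟨t, ht0, fun m hm => ?_, ?_⟩
  · have h1 : ‖ι m‖ < ρ := by rw [hm, norm_invCenter]; linarith
    have h2 := hB m h1
    rw [hm, invCenter_apply_four] at h2
    nlinarith
  ext q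
  simp only [mem_inter_iff, mem_range, mem_setOf_eq, comp_apply, mem_sphere_iff_norm, sub_zero]
  constructor
  · rintro ⟨⟨m, rfl⟩, hq4⟩
    refine ⟨?_, hq4⟩
    by_cases hm : ‖ι m‖ < ρ
    · exact norm_roundingMap_of_apply_four_eq_zero t ht0.ne' (hB m hm)
    · exfalso
      push Not at hm
      have hne : ι m ≠ invCenter t := by
        intro h; rw [h, norm_invCenter] at hm; linarith
      have hdist : ρ / 2 ≤ ‖ι m - invCenter t‖ := by
        have := norm_sub_norm_le (ι m) (invCenter t)
        rw [norm_invCenter] at this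
        linarith
      have h4 := one_sub_le_roundingMap_apply_four t hne
      have : (2 * t) ^ 2 / ‖ι m - invCenter t‖ ≤ (2 * t) ^ 2 / (ρ / 2) := by
        gcongr
      linarith
  · rintro ⟨hq, hq4⟩
    have hq41 : q 4 < 1 := by linarith
    set p := EuclideanGeometry.inversion (invCenter t) (2 * t) (q - (1 - 2 * t ^ 2) • e4)
      with hp
    have hp4 : p 4 = 0 := inversion_pre_apply_four t hq hq41
    have hpn : ‖p‖ < r := by
      refine (norm_inversion_pre_le t hq41).trans_lt ?_
      have : (2 * t) ^ 2 / (1 - q 4) ≤ (2 * t) ^ 2 / δ₁ := by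
        gcongr; linarith
      linarith
    obtain ⟨m, hm⟩ := hA p hp4 hpn
    exact ⟨⟨m, by rw [hm, hp, roundingMap_inversion t ht0.ne']⟩, hq4⟩

end RoundingMap

/-! ### §4 Flattening near a lowest point (chart, inverse function theorem, shear) -/

section FlatPoint

variable {M : Type*} [TopologicalSpace M] [CompactSpace M] [Nonempty M]
  [ChartedSpace (𝔼 4) M] [IsManifold (𝓡 4) ∞ M]

/-- **Flattening step.**  An injective immersion `f : M⁴ → ℝ⁵` of a closed nonempty manifold can
be replaced by an injective immersion `ι` (a vertical shear of `f`, recentred) whose image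
contains a flat horizontal disc `{h = 0, ‖p‖ < r}` and is flat inside a ball `B(0, ρ)`: at a
lowest point `m₀` of `f` the hypersurface is the graph of a smooth function of the shadow
(inverse function theorem in the chart at `m₀`), which the shear `vShear (χ · (g - h(f m₀)))`
flattens. [folklore] -/
theorem exists_flat_reembedding {f : M → 𝔼 5} (hf : ContMDiff (𝓡 4) (𝓡 5) ∞ f)
    (hinj : Injective f) (hd : ∀ m, Injective (mfderiv (𝓡 4) (𝓡 5) f m)) :
    ∃ ι : M → 𝔼 5, ContMDiff (𝓡 4) (𝓡 5) ∞ ι ∧ Injective ι ∧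
      (∀ m, Injective (mfderiv (𝓡 4) (𝓡 5) ι m)) ∧
      (∃ r > 0, ∀ p : 𝔼 5, p 4 = 0 → ‖p‖ < r → p ∈ range ι) ∧
      (∃ ρ > 0, ∀ m, ‖ι m‖ < ρ → ι m 4 = 0) := by
  /- Step 0: a lowest point `m₀`. -/
  obtain ⟨m₀, -, hmin⟩ := isCompact_univ.exists_isMinOn univ_nonempty
    (((EuclideanSpace.proj (4 : Fin 5)).continuous.comp hf.continuous).continuousOn)
  have hmin' : ∀ m, f m₀ 4 ≤ f m 4 := fun m => hmin (mem_univ m)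
  /- Step 1: the chart representative `G = f ∘ φ⁻¹` and its derivative `L` at `x₀ = φ m₀`. -/
  set φ := extChartAt (𝓡 4) m₀ with hφ
  set x₀ : 𝔼 4 := φ m₀ with hx₀
  set G : 𝔼 4 → 𝔼 5 := f ∘ φ.symm with hG
  have hGsm : ContDiffOn ℝ ∞ G φ.target :=
    contMDiffOn_iff_contDiffOn.mp (hf.comp_contMDiffOn (contMDiffOn_extChartAt_symm m₀))
  have hTo : IsOpen φ.target := isOpen_extChartAt_target m₀
  have hx₀T : x₀ ∈ φ.target := mem_extChartAt_target m₀
  have hφx₀ : φ.symm x₀ = m₀ := extChartAt_to_inv m₀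
  have hGx₀ : G x₀ = f m₀ := by simp only [hG, comp_apply, hφx₀]
  have hGat : ContDiffAt ℝ ∞ G x₀ := hGsm.contDiffAt (hTo.mem_nhds hx₀T)
  have hGdiff : DifferentiableAt ℝ G x₀ := hGat.differentiableAt (by simp)
  have hLeq : mfderiv (𝓡 4) (𝓡 5) f m₀ = fderiv ℝ G x₀ := by
    have hmd : MDifferentiableAt (𝓡 4) (𝓡 5) f m₀ := (hf m₀).mdifferentiableAt (by simp)
    rw [hmd.mfderiv]
    simp only [writtenInExtChartAt, extChartAt_model_space_eq_id, PartialEquiv.refl_coe,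
      modelWithCornersSelf_coe, range_id, fderivWithin_univ, id_comp]
    rfl
  set L : 𝔼 4 →L[ℝ] 𝔼 5 := fderiv ℝ G x₀ with hL
  have hLinj : Injective L := by
    have := hd m₀
    rwa [hLeq] at this
  /- the vertical derivative vanishes at the minimum -/
  have hL4 : ∀ v, L v 4 = 0 := by
    have hloc : IsLocalMin (fun x => G x 4) x₀ :=
      Filter.Eventually.of_forall fun x => by
        show G x₀ 4 ≤ G x 4
        rw [hGx₀]
        exact hmin' _
    have h0 := hloc.fderiv_eq_zero
    have hc := (((EuclideanSpace.proj (4 : Fin 5) : 𝔼 5 →L[ℝ] ℝ).hasFDerivAt (x := G x₀)).comp x₀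
      hGdiff.hasFDerivAt).fderiv
    have hc' : fderiv ℝ (fun x => G x 4) x₀ =
        (EuclideanSpace.proj (4 : Fin 5) : 𝔼 5 →L[ℝ] ℝ).comp L := hc
    intro v
    have := congrArg (fun T : 𝔼 4 →L[ℝ] ℝ => T v) (hc'.symm.trans h0)
    simpa using this
  /- Step 2: the horizontal part `Gh = shadow ∘ G` is a local diffeomorphism at `x₀`. -/
  set Gh : 𝔼 4 → 𝔼 4 := shadowProj ∘ G with hGh
  have hTinj : Injective ((shadowProjL : 𝔼 5 →L[ℝ] 𝔼 4).comp L) := by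
    intro v w hvw
    have h0 : shadowProj (L v - L w) = 0 := by
      change shadowProjL (L v - L w) = 0
      rw [map_sub]
      exact sub_eq_zero.mpr hvw
    have h4 : (L v - L w) 4 = (0 : 𝔼 5) 4 := by simp [hL4]
    have h0' : shadowProj (L v - L w) = shadowProj 0 := by
      rw [h0]; change _ = shadowProjL 0; rw [map_zero]
    exact hLinj (sub_eq_zero.mp (ext_of_shadowProj_eq h0' h4))
  obtain ⟨Λ, hΛ⟩ : ∃ Λ : 𝔼 4 ≃L[ℝ] 𝔼 4,
      (Λ : 𝔼 4 →L[ℝ] 𝔼 4) = (shadowProjL : 𝔼 5 →L[ℝ] 𝔼 4).comp L :=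
    ⟨(LinearEquiv.ofInjectiveEndo ((shadowProjL : 𝔼 5 →L[ℝ] 𝔼 4).comp L).toLinearMap
      hTinj).toContinuousLinearEquiv, by ext v; rfl⟩
  have hGh_sm : ContMDiffOn 𝓘(ℝ, 𝔼 4) 𝓘(ℝ, 𝔼 4) ∞ Gh φ.target :=
    contMDiffOn_iff_contDiffOn.mpr (shadowProjL.contDiff.comp_contDiffOn hGsm)
  have hGh_d : mfderiv 𝓘(ℝ, 𝔼 4) 𝓘(ℝ, 𝔼 4) Gh x₀ = (Λ : 𝔼 4 →L[ℝ] 𝔼 4) := by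
    rw [mfderiv_eq_fderiv, hΛ]
    exact ((shadowProjL : 𝔼 5 →L[ℝ] 𝔼 4).hasFDerivAt.comp x₀ hGdiff.hasFDerivAt).fderiv
  have hloc : IsLocalDiffeomorphAt 𝓘(ℝ, 𝔼 4) 𝓘(ℝ, 𝔼 4) ∞ Gh x₀ :=
    Literature.Topology.FourManifolds.isLocalDiffeomorphAt_of_mfderiv hTo hx₀T hGh_sm
      (by simp) Λ hGh_d
  set ψ := hloc.localInverse with hψ
  set a₀ : 𝔼 4 := Gh x₀ with ha₀
  have ha₀' : a₀ = shadowProj (f m₀) := by simp only [ha₀, hGh, comp_apply, hGx₀]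
  have ha₀s : a₀ ∈ ψ.source := hloc.localInverse_mem_source
  have hx₀t : x₀ ∈ ψ.target := hloc.localInverse_mem_target
  have hψsm : ContDiffOn ℝ ∞ ψ ψ.source :=
    contMDiffOn_iff_contDiffOn.mp hloc.localInverse_contMDiffOn
  have hright : ∀ a ∈ ψ.source, Gh (ψ a) = a := fun a ha => hloc.localInverse_right_inv ha
  have hleft : ∀ x ∈ ψ.target, ψ (Gh x) = x := fun x hx => hloc.localInverse_left_inv hx
  /- Step 3: the graph function `g` on the open set `O ∋ a₀`, the bump `χ`, the coefficient `β`. -/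
  set y₀ : ℝ := f m₀ 4 with hy₀
  set g : 𝔼 4 → ℝ := fun a => G (ψ a) 4 with hg
  set O : Set (𝔼 4) := ψ.source ∩ ψ ⁻¹' φ.target with hO
  have hOo : IsOpen O := hψsm.continuousOn.isOpen_inter_preimage ψ.open_source hTo
  have hψa₀ : ψ a₀ = x₀ := by rw [ha₀]; exact hleft x₀ hx₀t
  have ha₀O : a₀ ∈ O := ⟨ha₀s, by show ψ a₀ ∈ φ.target; rw [hψa₀]; exact hx₀T⟩
  have hgsm : ContDiffOn ℝ ∞ g O := by
    have h1 : ContDiffOn ℝ ∞ (G ∘ ψ) O :=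
      hGsm.comp (hψsm.mono inter_subset_left) fun a ha => ha.2
    exact (EuclideanSpace.proj (4 : Fin 5) : 𝔼 5 →L[ℝ] ℝ).contDiff.comp_contDiffOn h1
  obtain ⟨r₁, hr₁, hr₁O⟩ : ∃ r₁ > 0, closedBall a₀ r₁ ⊆ O :=
    nhds_basis_closedBall.mem_iff.mp (hOo.mem_nhds ha₀O)
  let χ : ContDiffBump a₀ := ⟨r₁ / 2, r₁, by positivity, by linarith⟩
  set β : 𝔼 4 → ℝ := fun a => χ a * (g a - y₀) with hβ
  have hβsm : ContDiff ℝ ∞ β := by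
    rw [contDiff_iff_contDiffAt]
    intro a
    by_cases ha : a ∈ O
    · exact χ.contDiff.contDiffAt.mul ((hgsm.contDiffAt (hOo.mem_nhds ha)).sub contDiffAt_const)
    · have hev : β =ᶠ[𝓝 a] fun _ => 0 := by
        filter_upwards [isClosed_closedBall.isOpen_compl.mem_nhds (fun h => ha (hr₁O h))]
          with b hb
        have hb' : χ.rOut ≤ dist b a₀ :=
          le_of_lt (not_le.mp fun h => hb (mem_closedBall.mpr h))
        simp [hβ, χ.zero_of_le_dist hb']
      exact (contDiffAt_const (c := (0 : ℝ))).congr_of_eventuallyEq hev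
  have hβa₀ : β a₀ = 0 := by
    have : g a₀ = y₀ := by simp only [hg, hψa₀, hGx₀, hy₀]
    simp [hβ, this]
  /- key computation: over the good region the sheared hypersurface is flat at height `y₀` -/
  have hflat : ∀ x ∈ ψ.target, χ (Gh x) = 1 → vShear β (G x) 4 = y₀ := by
    intro x hx hχ
    rw [vShear_apply_four]
    have h1 : shadowProj (G x) = Gh x := rfl
    have : β (shadowProj (G x)) = G x 4 - y₀ := by
      rw [h1, hβ]
      dsimp only
      rw [hχ, one_mul, hg]
      dsimp only
      rw [hleft x hx]
    rw [this]
    ring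
  /- Step 4: the new map `ι = Θ ∘ f - f m₀`. -/
  set ι : M → 𝔼 5 := fun m => vShear β (f m) - f m₀ with hι
  have hΨsm : ContDiff ℝ ∞ (fun p : 𝔼 5 => vShear β p - f m₀) :=
    (contDiff_vShear β hβsm).sub contDiff_const
  have hιsm : ContMDiff (𝓡 4) (𝓡 5) ∞ ι :=
    contMDiff_comp_of_contDiffAt hf (Ψ := fun p => vShear β p - f m₀) fun m => hΨsm.contDiffAt
  have hιinj : Injective ι := fun m m' h => hinj (vShear_injective β (sub_left_injective h))
  have hιd : ∀ m, Injective (mfderiv (𝓡 4) (𝓡 5) ι m) := fun m => by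
    refine injective_mfderiv_comp_of_contDiffAt hf (Ψ := fun p => vShear β p - f m₀)
      hΨsm.contDiffAt (hd m) ?_
    rw [fderiv_sub_const]
    exact injective_fderiv_vShear β hβsm (f m)
  have hιm₀ : ι m₀ = 0 := by
    simp only [hι, vShear, ← ha₀', hβa₀, zero_smul, sub_zero, sub_self]
  refine ⟨ι, hιsm, hιinj, hιd, ⟨r₁ / 2, by positivity, ?_⟩, ?_⟩
  · /- (a) the flat disc of radius `r₁/2` lies in the range -/
    intro p hp4 hpr
    set a : 𝔼 4 := a₀ + shadowProj p with ha
    have haball : a ∈ closedBall a₀ (r₁ / 2) := by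
      rw [mem_closedBall, dist_eq_norm, ha, add_sub_cancel_left]
      exact (norm_shadowProj_le p).trans hpr.le
    have haO : a ∈ O := hr₁O (closedBall_subset_closedBall (by linarith) haball)
    have hχa : χ a = 1 := χ.one_of_mem_closedBall haball
    set x := ψ a with hx
    have hxT : x ∈ ψ.target := ψ.map_source haO.1
    have hGhx : Gh x = a := hright a haO.1
    refine ⟨φ.symm x, ?_⟩
    show vShear β (G x) - f m₀ = p
    have h4 : (vShear β (G x) - f m₀) 4 = p 4 := by
      rw [PiLp.sub_apply, hflat x hxT (hGhx ▸ hχa), hp4, hy₀, sub_self]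
    have hsh : shadowProj (vShear β (G x) - f m₀) = shadowProj p := by
      change shadowProjL (vShear β (G x) - f m₀) = shadowProj p
      rw [map_sub, coe_shadowProjL, shadowProj_vShear, ← ha₀']
      change Gh x - a₀ = shadowProj p
      rw [hGhx, ha, add_sub_cancel_left]
    exact ext_of_shadowProj_eq hsh h4
  · /- (b) near the origin the image is flat -/
    set U : Set M := φ.source ∩ φ ⁻¹' ψ.target ∩ (shadowProj ∘ f) ⁻¹' ball a₀ (r₁ / 2) with hU
    have hUo : IsOpen U := by
      refine ((continuousOn_extChartAt m₀).isOpen_inter_preimage (isOpen_extChartAt_source m₀)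
        ψ.open_target).inter ?_
      exact isOpen_ball.preimage (shadowProjL.continuous.comp hf.continuous)
    have hm₀U : m₀ ∈ U := by
      refine ⟨⟨mem_extChartAt_source m₀, hx₀t⟩, ?_⟩
      show shadowProj (f m₀) ∈ ball a₀ (r₁ / 2)
      rw [← ha₀']
      exact mem_ball_self (by positivity)
    have hUflat : ∀ m ∈ U, ι m 4 = 0 := by
      rintro m ⟨⟨hms, hmt⟩, hmb⟩
      have hGm : G (φ m) = f m := by
        simp only [hG, comp_apply]
        rw [φ.left_inv hms]
      have hGhm : Gh (φ m) = shadowProj (f m) := by simp only [hGh, comp_apply, hGm]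
      have hχ : χ (Gh (φ m)) = 1 :=
        χ.one_of_mem_closedBall (by rw [hGhm]; exact ball_subset_closedBall hmb)
      show (vShear β (f m) - f m₀) 4 = 0
      rw [PiLp.sub_apply, ← hGm, hflat (φ m) hmt hχ, hy₀, sub_self]
    have hK : IsCompact (ι '' Uᶜ) := hUo.isClosed_compl.isCompact.image hιsm.continuous
    have h0 : (0 : 𝔼 5) ∉ ι '' Uᶜ := by
      rintro ⟨m, hm, hm0⟩
      have : m = m₀ := hιinj (hm0.trans hιm₀.symm)
      exact hm (this ▸ hm₀U)
    obtain ⟨ρ, hρ, hρK⟩ := Metric.isOpen_iff.mp hK.isClosed.isOpen_compl 0 h0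
    refine ⟨ρ, hρ, fun m hm => hUflat m ?_⟩
    by_contra hmU
    exact hρK (mem_ball_zero_iff.mpr hm) ⟨m, hmU, rfl⟩

end FlatPoint

end RoundPart

/-! ### §5 The discharge -/

open RoundPart in
/-- **Round lower part by an embedded connected sum with the unit sphere** (Kosinski,
*Differential Manifolds* (1993), Ch. VI, Prop. 1.3 and Thm. 2.2 (c), in embedded form):
discharge of `Literature.Topology.Immersions.exists_isSmoothEmbedding_roundPart`.  Proof:
flatten `ι₀(M)` near a lowest point by a vertical shear of `ℝ⁵`
(`RoundPart.exists_flat_reembedding`), then apply the rounding inversion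
(`RoundPart.exists_roundingMap_range`); the composite is an injective immersion of the compact
`M`, hence a smooth embedding.
[cite: Kosinski1993, Ch. VI, Prop. 1.3 and Thm. 2.2 (c)] -/
theorem exists_isSmoothEmbedding_roundPart_holds : exists_isSmoothEmbedding_roundPart := by
  intro M _ _ _ _ _ _ _ ι₀ hι₀ δ₁ hδ₁ hδ₁1
  obtain ⟨ι, hιsm, hιinj, hιd, ⟨r, hr, hA⟩, ⟨ρ, hρ, hB⟩⟩ :=
    exists_flat_reembedding hι₀.contMDiff hι₀.isEmbedding.injective
      (injective_mfderiv_of_isSmoothEmbedding hι₀)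
  obtain ⟨t, ht, hc, hrange⟩ := exists_roundingMap_range hr hρ hδ₁ hδ₁1 hA hB
  refine ⟨roundingMap t ∘ ι, ?_, hrange⟩
  exact Literature.Topology.FourManifolds.isSmoothEmbedding_of_injective_of_injective_mfderiv
    (contMDiff_comp_of_contDiffAt hιsm fun m => contDiffAt_roundingMap t (hc m)) (by simp)
    (fun m m' h => hιinj (roundingMap_injective t ht.ne' h))
    fun m => injective_mfderiv_comp_of_contDiffAt hιsm (contDiffAt_roundingMap t (hc m)) (hιd m)
      (injective_fderiv_roundingMap t ht.ne' (hc m))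

end Literature.Topology.Immersions

end
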